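import Summits.CriticalPhenomena.PercolationContinuityZ3.Theorems.Transplant.SkelPhiFaceNumsY
import Summits.CriticalPhenomena.PercolationContinuityZ3.Theorems.Transplant.SkelPhiFaceCellRead
import Summits.CriticalPhenomena.PercolationContinuityZ3.Theorems.Transplant.SkelPhiFaceRunN
import HarnessLib

/-!
# N1 ({±1} node), (F) inner route, part R5b-YP (hp-8 g33): **THE y′-FACE NUMBERS PROVIDER** — the `numsY` binder of the keystone
# `hkits_faceSteps_of_nums5` DISCHARGED from CENTRE-FREE data: the contact's cell is read off the frame box (`cell_of_frame_box`:
# `lev ∈ faceL ± E`, `|z⊥ − cen⊥| ≤ kE`), and the linear floors of `numsY_of_floors` are taken as ONE hypothesis quantified over the contact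
# cell `z` (structure `FloorsY` at the choices `yL, Nr, σT, N₃` — functions of `(x, du, j, z)` supplied by the caller), so that what remains
# for the (F) column is integer algebra uniform in the centre.
builds on p205010 (kernel theorem, internal audit signed; external expert review pending) — nothing in this file uses p205010; no claim about the open node.
Lane `prim-bschramm`, seat `prim-hp-8` (gen 33); helper file (`--supports stmt-CriticalPhenomena-4575 --as helper`).
* structure **`Skelφ.FloorsY`** (the linear floors of a y′-face centre with contact cell `z`), **`Skelφ.numsY_provider`** (a `def`).
[cite: KozmaNitzan2024, §4 Lemma 11 (pp. 22–23), Lemma 12 (pp. 23–25)] [cite: MartineauTassion2017, §4.1, §4.3 Lemma 4.2]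
-/

noncomputable section

open scoped Classical

namespace Summit.CriticalPhenomena.PercolationContinuityZ3.Theorems.Transplant

namespace Skelφ

open Literature.Probability.Percolation Literature.Probability.LatticeModels SimpleGraph KNCells
open Literature.Probability.Percolation.KozmaNitzan
open Literature.Probability.Percolation.KozmaNitzan.Cells (oth oth_ne sgOf sgOf_sign stepVec_apply_fst eq_oth_of_ne oth_oth)
open KNLevels ChainPlanar ChainPara
open Literature.Barriers.CriticalPhenomena (graphBall mem_graphBall_self graphBall_mono)
open BoxProdZ2 (ConcRadiiG)
open TwoAxis.Para (modulus coarse lam0 lam1)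

variable {V : Type} [DecidableEq V] {G : SimpleGraph V} [G.LocallyFinite] {φ : V → Site 2}

/-- **The linear floors of a y′-face centre** with contact cell `z` (habitat `flo = 5r + 10sj + 3 − lev z`, `fhi = 25r − 2 − lev z`,
`fw = 5r⊥ − 4 − k₀ − |z⊥ − cen⊥|`): exactly the integer hypotheses of `numsY_of_floors`. [this work] -/
structure FloorsY (pr : FinePrm) (nL : ℕ) (κ₀ κ₁ mod Vb : ℤ) (ℓ' : ℕ) (P : PCells2) (b₀ : Fin 2 → ℕ) (x : Site 2) (du : MDir) (j : ℕ)
    (k₀ : ℤ) (r kb : ℕ) (z : Site 2) (kA : Fin 2 → ℤ) (B : BridgePrm) (R's qB R'₃ qB₃ : ℕ) (yL : Site 2) (Nr N₃ : ℕ) (σT : ℤ) : Prop where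
  -- the habitat versus the zone bounds
  hfR : (5 * (P.r du.1 : ℤ) + 10 * P.s du.1 * j + 3 - P.lev du x z) ≤ -kA du.1 ∧ kA du.1 ≤ (25 * (P.r du.1 : ℤ) - 2 - P.lev du x z) ∧
    kA (oth du.1) ≤ (5 * (P.r (oth du.1) : ℤ) - 4 - k₀ - |z (oth du.1) - P.cen x (oth du.1)|)
  hZfar : P.lev du x z + kA du.1 + 1 < 20 * (P.r du.1 : ℤ) - b₀ du.1
  hσT : σT = 1 ∨ σT = -1
  -- floors: along y′-run at yL (sign σ = sgOf du): along habitat on axis 1, transverse on axis 0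
  FA1 : sgOf du = 1 → ∀ k ≤ Nr, mod * ((5 * (P.r du.1 : ℤ) + 10 * P.s du.1 * j + 3 - P.lev du x z) - coarse pr.c₁ (pr.D / 2) pr.D (lam1 pr.A nL pr.h yL)) ≤
      κ₁ * ((shearUnit nL pr.h : ℤ) * (ySLo nL ℓ' pr.h qB R's 1 k - 1)) - mod + 1
  FA2 : sgOf du = 1 → ∀ k ≤ Nr, mod * (coarse pr.c₁ (pr.D / 2) pr.D (lam1 pr.A nL pr.h yL) + 1) +
      κ₁ * ((shearUnit nL pr.h : ℤ) * ySHi nL ℓ' pr.h qB R's 1 k + shearUnit nL pr.h - 1) ≤ mod * (25 * (P.r du.1 : ℤ) - 2 - P.lev du x z)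
  FA3 : sgOf du = -1 → ∀ k ≤ Nr, mod * ((5 * (P.r du.1 : ℤ) + 10 * P.s du.1 * j + 3 - P.lev du x z) + coarse pr.c₁ (pr.D / 2) pr.D (lam1 pr.A nL pr.h yL) + 1) ≤
      -(κ₁ * ((shearUnit nL pr.h : ℤ) * ySHi nL ℓ' pr.h qB R's (-1) k + shearUnit nL pr.h - 1))
  FA4 : sgOf du = -1 → ∀ k ≤ Nr, -(mod * coarse pr.c₁ (pr.D / 2) pr.D (lam1 pr.A nL pr.h yL)) -
      κ₁ * ((shearUnit nL pr.h : ℤ) * (ySLo nL ℓ' pr.h qB R's (-1) k - 1)) + mod - 1 ≤ mod * (25 * (P.r du.1 : ℤ) - 2 - P.lev du x z)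
  FA5 : ∀ k ≤ Nr, (nL : ℤ) * mod * (-(5 * (P.r (oth du.1) : ℤ) - 4 - k₀ - |z (oth du.1) - P.cen x (oth du.1)|) - coarse pr.c₀ (pr.D / 2) pr.D (lam0 pr.A pr.vα pr.vβ yL)) ≤ -(κ₀ * (yBnd nL ℓ' pr.h mod qB R's k + 2 * nL)) - nL * mod
  FA6 : ∀ k ≤ Nr, (nL : ℤ) * mod * (coarse pr.c₀ (pr.D / 2) pr.D (lam0 pr.A pr.vα pr.vβ yL) + 1) + κ₀ * (yBnd nL ℓ' pr.h mod qB R's k + nL) ≤ nL * mod * (5 * (P.r (oth du.1) : ℤ) - 4 - k₀ - |z (oth du.1) - P.cen x (oth du.1)|)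
  -- floors: tangential x-run at yT (sign σT)
  FT1 : sgOf du = 1 → ∀ k ≤ N₃, mod * ((5 * (P.r du.1 : ℤ) + 10 * P.s du.1 * j + 3 - P.lev du x z) - coarse pr.c₁ (pr.D / 2) pr.D (lam1 pr.A nL pr.h (yL + crossOffY nL ℓ' pr.h pr.vα (sgOf du) Nr))) ≤
      -(κ₁ * (shearUnit nL pr.h : ℤ) * (xBoxB nL ℓ' pr.h R'₃ k + 1)) - mod + 1
  FT2 : sgOf du = 1 → ∀ k ≤ N₃, mod * (coarse pr.c₁ (pr.D / 2) pr.D (lam1 pr.A nL pr.h (yL + crossOffY nL ℓ' pr.h pr.vα (sgOf du) Nr)) + 1) +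
      κ₁ * ((shearUnit nL pr.h : ℤ) * xBoxB nL ℓ' pr.h R'₃ k + shearUnit nL pr.h - 1) ≤ mod * (25 * (P.r du.1 : ℤ) - 2 - P.lev du x z)
  FT3 : sgOf du = -1 → ∀ k ≤ N₃, mod * ((5 * (P.r du.1 : ℤ) + 10 * P.s du.1 * j + 3 - P.lev du x z) + coarse pr.c₁ (pr.D / 2) pr.D (lam1 pr.A nL pr.h (yL + crossOffY nL ℓ' pr.h pr.vα (sgOf du) Nr)) + 1) ≤
      -(κ₁ * ((shearUnit nL pr.h : ℤ) * xBoxB nL ℓ' pr.h R'₃ k + shearUnit nL pr.h - 1))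
  FT4 : sgOf du = -1 → ∀ k ≤ N₃, -(mod * coarse pr.c₁ (pr.D / 2) pr.D (lam1 pr.A nL pr.h (yL + crossOffY nL ℓ' pr.h pr.vα (sgOf du) Nr))) +
      κ₁ * (shearUnit nL pr.h : ℤ) * (xBoxB nL ℓ' pr.h R'₃ k + 1) + mod - 1 ≤ mod * (25 * (P.r du.1 : ℤ) - 2 - P.lev du x z)
  FT5 : ∀ k ≤ N₃, (nL : ℤ) * mod * (-(5 * (P.r (oth du.1) : ℤ) - 4 - k₀ - |z (oth du.1) - P.cen x (oth du.1)|) - coarse pr.c₀ (pr.D / 2) pr.D (lam0 pr.A pr.vα pr.vβ (yL + crossOffY nL ℓ' pr.h pr.vα (sgOf du) Nr))) ≤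
      κ₀ * mod * xSLo nL qB₃ R'₃ σT k - κ₀ * Vb * (shearUnit nL pr.h : ℤ) * (xBoxB nL ℓ' pr.h R'₃ k + 1) - κ₀ * nL - nL * mod
  FT6 : ∀ k ≤ N₃, (nL : ℤ) * mod * (coarse pr.c₀ (pr.D / 2) pr.D (lam0 pr.A pr.vα pr.vβ (yL + crossOffY nL ℓ' pr.h pr.vα (sgOf du) Nr)) + 1) +
      κ₀ * mod * xSHi nL qB₃ R'₃ σT k + κ₀ * Vb * (shearUnit nL pr.h : ℤ) * (xBoxB nL ℓ' pr.h R'₃ k + 1) ≤ nL * mod * (5 * (P.r (oth du.1) : ℤ) - 4 - k₀ - |z (oth du.1) - P.cen x (oth du.1)|)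
  -- floors: the target box on the x-run's last core
  FL1 : (nL : ℤ) * mod * (P.cen (x + stepVec du) 0 - b₀ 0 + 2 - z 0 -
      coarse pr.c₀ (pr.D / 2) pr.D (lam0 pr.A pr.vα pr.vβ (yL + crossOffY nL ℓ' pr.h pr.vα (sgOf du) Nr))) ≤
      κ₀ * mod * xCSLo nL qB₃ R'₃ σT (N₃ + 1) - κ₀ * Vb * (shearUnit nL pr.h : ℤ) * (xCoreB nL ℓ' pr.h R'₃ (N₃ + 1) + 1) - κ₀ * nL - nL * mod
  FL2 : (nL : ℤ) * mod * (coarse pr.c₀ (pr.D / 2) pr.D (lam0 pr.A pr.vα pr.vβ (yL + crossOffY nL ℓ' pr.h pr.vα (sgOf du) Nr)) + 1) +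
      κ₀ * mod * xCSHi nL qB₃ R'₃ σT (N₃ + 1) + κ₀ * Vb * (shearUnit nL pr.h : ℤ) * (xCoreB nL ℓ' pr.h R'₃ (N₃ + 1) + 1) ≤
      nL * mod * (P.cen (x + stepVec du) 0 + b₀ 0 - 2 - z 0)
  FL3 : mod * (P.cen (x + stepVec du) 1 - b₀ 1 + 2 - z 1 - coarse pr.c₁ (pr.D / 2) pr.D (lam1 pr.A nL pr.h (yL + crossOffY nL ℓ' pr.h pr.vα (sgOf du) Nr))) ≤
      -(κ₁ * (shearUnit nL pr.h : ℤ) * (xCoreB nL ℓ' pr.h R'₃ (N₃ + 1) + 1)) - mod + 1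
  FL4 : mod * (coarse pr.c₁ (pr.D / 2) pr.D (lam1 pr.A nL pr.h (yL + crossOffY nL ℓ' pr.h pr.vα (sgOf du) Nr)) + 1) +
      κ₁ * ((shearUnit nL pr.h : ℤ) * xCoreB nL ℓ' pr.h R'₃ (N₃ + 1) + shearUnit nL pr.h - 1) ≤ mod * (P.cen (x + stepVec du) 1 + b₀ 1 - 2 - z 1)
  -- the cross link floors
  hq₃ : 2 * (nL : ℤ) + ((Nr : ℤ) + 1) * R's ≤ qB₃
  hW : ((Nr : ℤ) + 1) * (((nL : ℤ) * ℓ' / (shearUnit nL pr.h : ℕ) + 1) - ((nL : ℤ) * ℓ' - (shearUnit nL pr.h : ℕ) + 1) / (shearUnit nL pr.h : ℕ)) + qB +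
      ((Nr : ℤ) + 1) * R's + 2 ≤ ((nL * ℓ' / shearUnit nL pr.h + 1 : ℕ) : ℤ)
  -- the bridge box, clearances, reaches
  hxaY : ∀ y ∈ Finset.Icc B.core1Lo B.core1Hi,
      -((((nL : ℤ) + pr.vα).toNat : ℕ) : ℤ) ≤ y 0 - sgOf du * yL 0 ∧ y 0 - sgOf du * yL 0 ≤ ((((nL : ℤ) - pr.vα).toNat : ℕ) : ℤ)
  hxbY : ∀ y ∈ Finset.Icc B.core1Lo B.core1Hi,
      |sgOf du * ((nL : ℤ) * (y 1 - yL 1) - pr.h * (sgOf du * y 0 - yL 0))| + shearUnit nL pr.h ≤ ((qB : ℤ) + 1) * shearUnit nL pr.h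
  hclr : ∀ k ≤ Nr, (kb : ℤ) < yBoxLoT nL pr.vα R's k + sgOf du * yL 0
  hclr₃ : ∀ k ≤ N₃, ∀ b : ℤ, min (σT * xBoxLoA nL qB₃ R'₃ k) (σT * xBoxHiA nL qB₃ R'₃ k) ≤ b →
      b ≤ max (σT * xBoxLoA nL qB₃ R'₃ k) (σT * xBoxHiA nL qB₃ R'₃ k) → (kb : ℤ) < sgOf du * (b + (yL + crossOffY nL ℓ' pr.h pr.vα (sgOf du) Nr) 0)
  hπ2Y : ∀ k ≤ Nr, ((yL 0).natAbs + (yL 1).natAbs) + (((((k + 1 : ℕ) : ℤ) * pr.vα).natAbs +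
      (((shearUnit nL pr.h : ℤ) * |((k + 1 : ℕ) : ℤ) * (yPrmW nL ℓ' pr.h pr.vα R's qB Nr).sLo| + |pr.h| * |((k + 1 : ℕ) : ℤ) * pr.vα| + shearUnit nL pr.h) / nL).natAbs + 1))
      ≤ r
  hπ3Y : (((yL + crossOffY nL ℓ' pr.h pr.vα (sgOf du) Nr) 0).natAbs + ((yL + crossOffY nL ℓ' pr.h pr.vα (sgOf du) Nr) 1).natAbs) + (N₃ + 1) * shearUnit nL pr.h ≤ r

/-- **THE y′-FACE NUMBERS PROVIDER**: the `numsY` binder of `hkits_faceSteps_of_nums5` from centre-free data (see `numsX_provider`).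
[cite: KozmaNitzan2024, §4 Lemma 12 (pp. 23–25)] -/
def numsY_provider (hstep : Steps G φ) (pr : FinePrm) (w₀ : V) {nL : ℕ} (hn : pr.n = nL) (hnL : 1 ≤ nL) (hvL : |pr.vα| ≤ nL)
    (hc₀ : 0 < pr.c₀) (hc₁ : 0 < pr.c₁) (hD : 0 < pr.D) (hlipψ : Lip G (pr.ψ φ w₀)) (hws : WeakSteps G (pr.ψ φ w₀))
    {κ₀ κ₁ mod Vb : ℤ} (hA : 0 < pr.A) (hκ₀ : 0 ≤ κ₀) (hVb : |pr.vα| ≤ Vb) (hc0 : pr.c₀ = pr.A * κ₀) (hc1 : pr.c₁ = pr.A * κ₁)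
    (hmod : modulus nL pr.h pr.vα pr.vβ = mod) (hmod0 : 0 < mod) (hDm : pr.D = pr.A ^ 2 * mod)
    {ℓ' : ℕ} (hlay : (nL + pr.h.natAbs : ℕ) ≤ (nL : ℤ) * ℓ' + 1) (hmodlo : (nL : ℤ) * ℓ' - (shearUnit nL pr.h : ℤ) + 1 ≤ mod)
    (hmodhi : mod ≤ (nL : ℤ) * ℓ')
    (P : PCells2) (Λ : ConcRadiiG) (b₀ : Fin 2 → ℕ) {L' : ℕ} (hL' : 1 ≤ L') (hrM : ∀ (a' : ℕ) (x : Site 2) (du : MDir), L' ≤ Λ.rM a' (x + stepVec du))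
    {k₀ : ℤ} (hk₀ : 0 ≤ k₀) {r : ℕ} (hrE : ∀ (a' : ℕ) (x : Site 2) (du : MDir), r ≤ Λ.rE a' x du) (kb : ℕ)
    (aw : MDir → ℕ) (E : ℕ) {kE : ℤ} (hnz : ∀ du : MDir, pr.lvGen du.1 (pr.bOf du.1) ≠ 0)
    (hroom : ∀ du : MDir, pr.Mabs * (aw du + E) + pr.rdN du.1 (pr.bOf du.1) * (E + 1) * pr.D ≤ pr.rdK du.1 (pr.bOf du.1) * kE * pr.D)
    (Λc : V → ℕ → Finset V) (Mz : ℕ) (kA : Fin 2 → ℤ) (hZk : ∀ (c' : V) (du : MDir), ∀ v ∈ Λc c' Mz, |pr.ψ φ c' v du.1| ≤ kA du.1)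
    (B : ℤ → BridgePrm) (R's qB R'₃ qB₃ : ℕ) (yLF : Site 2 → MDir → ℕ → Site 2 → Site 2) (NrF N3F : Site 2 → MDir → ℕ → Site 2 → ℕ)
    (σTF : Site 2 → MDir → ℕ → Site 2 → ℤ)
    (floors : ∀ (x : Site 2) (du : MDir) (j : ℕ) (z : Site 2), du.1 = 1 → j < P.K → (P.faceL du.1 j : ℤ) - E ≤ P.lev du x z →
      P.lev du x z ≤ P.faceL du.1 j + E → |z (oth du.1) - P.cen x (oth du.1)| ≤ kE →
      FloorsY pr nL κ₀ κ₁ mod Vb ℓ' P b₀ x du j k₀ r kb z kA (B (sgOf du)) R's qB R'₃ qB₃ (yLF x du j z) (NrF x du j z) (N3F x du j z) (σTF x du j z)) :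
    ∀ (a' : ℕ) (x : Site 2) (du : MDir) (j : ℕ) (pc : ℤ) (c' : V), du.1 = 1 → j < P.K → ∀ yF : V,
      pr.ψ φ w₀ yF = P.faceCen x du j → pc = relφ φ w₀ yF (pr.bOf du.1) →
      pr.frame φ w₀ du.1 (pr.bOf du.1) c' ∈ Finset.Icc (loN P x du j pc (aw du) - ((E : ℕ) : Site 2)) (hiN P x du j pc (aw du) + ((E : ℕ) : Site 2)) →
      c' ∈ graphBall G w₀ (Λ.rE a' x du - r) →
      FaceRunNums3 G φ (pr.ψ φ w₀) false c' pr.A nL pr.h pr.vα pr.vβ pr.c₀ pr.c₁ pr.D du (sgOf du) (B (sgOf du)) ℓ' R's qB R'₃ qB₃ pr.vα hnL hvL hlay kb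
        (P.farCore x du j k₀) (targetMM G φ pr P w₀ Λ b₀ a' x du L') (Λc c' Mz) r (kA du.1) (kA (oth du.1)) := by
  intro a' x du j pc c' hI hj yF hyF hpc hbox hball
  obtain ⟨hL1, hL2, hwc⟩ := cell_of_frame_box (φ := φ) pr w₀ hc₀ hc₁ hD P (hnz du) hyF hpc (hroom du) hbox
  have F := floors x du j (pr.ψ φ w₀ c') hI hj hL1 hL2 hwc
  refine Classical.choice (numsY_of_floors hstep pr w₀ hn hnL hvL hD hlipψ hws hA hκ₀ hVb hc0 hc1 hmod hmod0 hDm hlay hmodlo hmodhi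
    P Λ b₀ a' x du hI j hL' (hrM a' x du) hk₀ c' hball (hrE a' x du) kb le_rfl (le_of_eq (by ring)) (le_of_eq (by ring)) (le_of_eq (by ring))
    F.hfR (Λc c' Mz) (hZk c' du) F.hZfar (B (sgOf du)) R's qB R'₃ qB₃ (yLF x du j (pr.ψ φ w₀ c')) (NrF x du j (pr.ψ φ w₀ c'))
    (N3F x du j (pr.ψ φ w₀ c')) F.hσT F.FA1 F.FA2 F.FA3 F.FA4 F.FA5 F.FA6 F.FT1 F.FT2 F.FT3 F.FT4 F.FT5 F.FT6 F.FL1 F.FL2 F.FL3 F.FL4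
    F.hq₃ F.hW F.hxaY F.hxbY F.hclr F.hclr₃ F.hπ2Y F.hπ3Y)

end Skelφ

end Summit.CriticalPhenomena.PercolationContinuityZ3.Theorems.Transplant

end
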